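import Literature.NumberTheory.Automorphic.PiOfArtinRepAtSigmaUnramifiedPlacesArtinSideProofs
import Literature.NumberTheory.GaloisRepresentations.TateTwistFrobeniusProofs
import HarnessLib

/-!
# Euler factors of twisted Artin representations, Euler polynomials, and one factor of an
Euler product
(pure proofs; tools for `Automorphic/PiOfArtinRepAtSigmaUnramifiedPlacesHeckeTheoryProofs`)

Jacquet–Langlands' proof of Gelbart's Prop. 4.1 (*Automorphic Forms on GL(2)*, LNM 114 (1970),
proof of Thm. 12.2, p. 210) twists `π` and `σ` by an idèle class character `ω` which is trivial
at the place `v` under study and so ramified at the other exceptional places `w` that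
"`L(s, ω_w ⊗ σ_w) = L(s, ω_w ⊗ π_w) = 1`".  This file proves the **Galois side** of these local
computations for the twist `σ ⊗ χ` (`FramedRep.twist`) of a framed Artin representation
`σ : Γ_F → GL_n(ℂ)` by the Galois avatar `χ : Γ_F → ℂˣ` of `ω`, and its contragredient
`(σ ⊗ χ)^∨` (`FramedRep.dual`), together with two pieces of bookkeeping used to compare Euler
products:

* `ArtinRep.eulerFactorAt_eq_one_of_fixedSubmodule_eq_bot` — if the inertia group at some prime
  above `u` has no non-zero invariant vector then `L_u(ρ, T) = 1` (Neukirch VII §10, proof of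
  (10.6): "if `χ(I_𝔓) ≠ 1` then `V^{I_𝔓} = 0` and the Euler factor does not occur").
* `FramedArtinRep.fixedSubmodule_eq_bot_of_eq_smul` — **a sufficiently ramified twist kills the
  inertia invariants**: if some `g` in the subgroup `H` acts through `τ(g) = c · M` with
  `M^m = 1` and `c^m ≠ 1`, then `(ℂⁿ)^H = 0` (a fixed vector `x` satisfies `x = c^m M^m x = c^m x`).
  With `M = σ(g)`, `m = |σ(Γ_F)|` (`coe_pow_natCard_range`, `coe_dual_pow_natCard_range`) and
  `c = χ(g)^{±1}` of order `> m` this is "`ω_w` so ramified that `L(s, ω_w ⊗ σ_w) = 1`"; with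
  `M = 1` (`σ` unramified at `u`) and `c = χ(g) ≠ 1` it is "`L_u(σ ⊗ χ) = 1` at a place where `σ`
  is unramified and `χ` is ramified".
* `FramedArtinRep.coe_dual_twist_apply` — `(σ ⊗ χ)^∨(g) = χ(g)⁻¹ · σ^∨(g)`.
* `charValue_eq_of_forall_inertia` — a character unramified at `u` takes the same value on all
  arithmetic Frobenius elements at all primes above `u` (Serre 1968, Ch. I §2.1).
* `exists_eq_eulerPolynomial_of_eval_zero_eq_one`, `eq_of_eulerPolynomial_eq`,
  `eval_eulerPolynomial_cpow_neg` — a complex polynomial with constant term `1` is an Euler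
  polynomial `∏_{b ∈ B} (1 - b X)` with `0 ∉ B`, `card B = deg`; such `B` is unique; its value at
  `q^{-s}` is the product of the Euler terms `1 - b q^{-s}`.
* `tprod_eq_mul_tprod_update` — `∏' u, f u = f b · ∏' u, (update f b 1) u` for a convergent
  product in `ℂ` with `f b ≠ 0` (the monoid version of Mathlib's `tprod_eq_mul_tprod_ite`, whose
  group version does not apply to `(ℂ, ·)`).

No definition and no named fact is introduced (D-0026).  The first three theorems are
dot-notation extensions of `GaloisRepresentations.ArtinRep` / `FramedArtinRep` declared with
their absolute names (conventions §2).

## References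

* H. Jacquet, R. P. Langlands, *Automorphic Forms on GL(2)*, LNM 114 (1970), proof of Thm. 12.2,
  p. 210; Lemma 12.5; Prop. 3.8. [JacquetLanglands1970]
* J. Neukirch, *Algebraic Number Theory* (1999), VII §10, (10.1) and proof of (10.6).
  [NeukirchANT1999]
* J.-P. Serre, *Abelian ℓ-adic representations and elliptic curves* (1968), Ch. I §2.1.
  [SerreAbelianLadic1968]
-/

noncomputable section

open scoped MatrixGroups NumberField Polynomial Matrix Pointwise
open NumberField IsDedekindDomain Field Polynomial Complex Filter Topology Set
open Literature.NumberTheory.GaloisRepresentations (ArtinRep FramedArtinRep absIntegers)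
open Literature.NumberTheory.LFunctions

namespace Literature.NumberTheory.Automorphic

/-! ### Euler factors of twists and their contragredients -/

section GaloisSide

variable {F : Type} [Field F] [NumberField F] {n : ℕ}

/-- **No inertia invariants ⇒ trivial Euler factor.**  If for some prime `𝔓` above the finite
place `u` the inertia group `I_𝔓` has no non-zero invariant vector on the Artin representation
`ρ`, then `L_u(ρ, T) = det(1 - T ρ(Frob_𝔓) | V^{I_𝔓}) = 1` (the characteristic polynomial of an
endomorphism of the zero space is `1`; `eulerFactorAt` may be computed at any `(𝔓, Frob_𝔓)`,
`ArtinRep.eulerFactorAt_spec_holds`).  Neukirch VII §10, proof of (10.6). Dot-notation extension of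
`GaloisRepresentations.ArtinRep` declared from `Automorphic/`.
[cite: NeukirchANT1999, Ch. VII §10 Thm. (10.6) (proof)] -/
theorem
    _root_.Literature.NumberTheory.GaloisRepresentations.ArtinRep.eulerFactorAt_eq_one_of_fixedSubmodule_eq_bot
    {V : Type*} [AddCommGroup V] [Module ℂ V] [TopologicalSpace V] [FiniteDimensional ℂ V]
    (ρ : ArtinRep F V) {u : HeightOneSpectrum (𝓞 F)} {𝔓 : Ideal (absIntegers (𝓞 F) F)}
    (h𝔓 : 𝔓 ∈ u.primesAbove)
    (hbot : ρ.fixedSubmodule (𝔓.inertia (absoluteGaloisGroup F)) = ⊥) :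
    ρ.eulerFactorAt u = 1 := by
  obtain ⟨g, hg⟩ := HeightOneSpectrum.exists_isArithFrobAt_of_mem_primesAbove_holds h𝔓
  have hspec := GaloisRepresentations.ArtinRep.eulerFactorAt_spec_holds ρ h𝔓 hg
  have hrank : Module.finrank ℂ (ρ.fixedSubmodule (𝔓.inertia (absoluteGaloisGroup F))) = 0 := by
    rw [hbot, finrank_bot]
  have hchar : (ρ.restrictInertiaInvariants 𝔓 ⟨g, by
      haveI := h𝔓.1; exact hg.mem_stabilizer⟩).charpoly = 1 := by
    rw [← (LinearMap.charpoly_monic _).natDegree_eq_zero, LinearMap.charpoly_natDegree, hrank]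
  rw [hspec, GaloisRepresentations.ArtinRep.eulerPolynomial, hchar, ← C_1, reverse_C]

omit [NumberField F] in
/-- **A sufficiently ramified twist kills the invariants.**  Let `τ : Γ_F → GL_n(ℂ)`, `H ≤ Γ_F`,
and suppose some `g ∈ H` acts as `τ(g) = c · M` with `M^m = 1` and `c^m ≠ 1`.  Then `H` has no
non-zero invariant vector on `ℂⁿ`: an invariant `x` satisfies `x = c (M x)`, hence
`x = c^k (M^k x)` for all `k`, so `x = c^m x` and `x = 0`.  Applied with `H = I_w`, `M = σ(g)`,
`m = |σ(Γ_F)|`, `c = χ(g)` of order `> m`: this is "choose `ω` so ramified at `w` that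
`L(s, ω_w ⊗ σ_w) = 1`" on the Galois side (Jacquet–Langlands 1970, p. 210). Dot-notation
extension of `GaloisRepresentations.FramedArtinRep` declared from `Automorphic/`.
[cite: JacquetLanglands1970, proof of Thm. 12.2, p. 210] -/
theorem
    _root_.Literature.NumberTheory.GaloisRepresentations.FramedArtinRep.fixedSubmodule_eq_bot_of_eq_smul
    (τ : FramedArtinRep F n) (H : Subgroup (absoluteGaloisGroup F)) {g : absoluteGaloisGroup F}
    (hg : g ∈ H) {c : ℂ} {M : Matrix (Fin n) (Fin n) ℂ} {m : ℕ}
    (hτ : ((τ g : GL (Fin n) ℂ) : Matrix (Fin n) (Fin n) ℂ) = c • M) (hM : M ^ m = 1)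
    (hc : c ^ m ≠ 1) :
    τ.toArtinRep.fixedSubmodule H = ⊥ := by
  rw [Submodule.eq_bot_iff]
  intro x hx
  have hfix : c • (M *ᵥ x) = x := by
    have h := (τ.toArtinRep.mem_fixedSubmodule_iff H x).mp hx g hg
    rw [GaloisRepresentations.FramedRep.toContinuousRep_apply_apply, hτ, Matrix.smul_mulVec]
      at h
    exact h
  have hiter : ∀ k : ℕ, x = c ^ k • (M ^ k *ᵥ x) := by
    intro k
    induction k with
    | zero => simp
    | succ k ih =>
        calc x = c ^ k • (M ^ k *ᵥ x) := ih
          _ = c ^ k • (M ^ k *ᵥ (c • (M *ᵥ x))) := by rw [hfix]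
          _ = c ^ (k + 1) • (M ^ (k + 1) *ᵥ x) := by
            rw [Matrix.mulVec_smul, smul_smul, Matrix.mulVec_mulVec, ← pow_succ, ← pow_succ]
  have hx := hiter m
  rw [hM, Matrix.one_mulVec] at hx
  have h2 : (1 - c ^ m) • x = 0 := by rw [sub_smul, one_smul, ← hx, sub_self]
  rcases smul_eq_zero.mp h2 with h | h
  · exact absurd (sub_eq_zero.mp h).symm hc
  · exact h

omit [NumberField F] in
/-- `σ(g)^m = 1` as a matrix, for `m = |σ(Γ_F)|` (`Nat.card` of the range; Lagrange,
Mathlib `pow_card_eq_one'`; for an infinite range `m = 0` and the statement is trivial).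
[folklore] -/
theorem FramedArtinRep.coe_pow_natCard_range (σ : FramedArtinRep F n) (g : absoluteGaloisGroup F) :
    ((σ g : GL (Fin n) ℂ) : Matrix (Fin n) (Fin n) ℂ) ^ Nat.card σ.toMonoidHom.range = 1 := by
  have hmem : σ.toMonoidHom g ∈ σ.toMonoidHom.range := ⟨g, rfl⟩
  have h : (⟨σ.toMonoidHom g, hmem⟩ : σ.toMonoidHom.range) ^ Nat.card σ.toMonoidHom.range = 1 :=
    pow_card_eq_one'
  have h' : (σ g : GL (Fin n) ℂ) ^ Nat.card σ.toMonoidHom.range = 1 := by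
    have h2 := congrArg Subtype.val h
    rwa [Subgroup.coe_pow, Subgroup.coe_one] at h2
  rw [← Units.val_pow_eq_pow_val, h', Units.val_one]

omit [NumberField F] in
/-- `σ^∨(g)^m = 1` as a matrix, for `m = |σ(Γ_F)|` (`σ^∨(g) = ((σ g)⁻¹)ᵀ`,
`FramedRep.coe_dual_apply`). [folklore] -/
theorem FramedArtinRep.coe_dual_pow_natCard_range (σ : FramedArtinRep F n)
    (g : absoluteGaloisGroup F) :
    ((GaloisRepresentations.FramedRep.dual σ g : GL (Fin n) ℂ) : Matrix (Fin n) (Fin n) ℂ) ^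
        Nat.card σ.toMonoidHom.range = 1 := by
  have hmem : σ.toMonoidHom g ∈ σ.toMonoidHom.range := ⟨g, rfl⟩
  have h : (⟨σ.toMonoidHom g, hmem⟩ : σ.toMonoidHom.range) ^ Nat.card σ.toMonoidHom.range = 1 :=
    pow_card_eq_one'
  have h' : (σ g : GL (Fin n) ℂ) ^ Nat.card σ.toMonoidHom.range = 1 := by
    have h2 := congrArg Subtype.val h
    rwa [Subgroup.coe_pow, Subgroup.coe_one] at h2
  rw [GaloisRepresentations.FramedRep.coe_dual_apply, ← Matrix.transpose_pow,
    ← Units.val_pow_eq_pow_val, inv_pow, h', inv_one, Units.val_one, Matrix.transpose_one]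

omit [NumberField F] in
/-- **The contragredient of a twist**: `(σ ⊗ χ)^∨(g) = χ(g)⁻¹ · σ^∨(g)` as matrices
(`(χ(g) σ(g))⁻ᵀ = χ(g)⁻¹ σ(g)⁻ᵀ`). [folklore] -/
theorem FramedArtinRep.coe_dual_twist_apply (σ : FramedArtinRep F n)
    (χ : absoluteGaloisGroup F →ₜ* ℂˣ) (g : absoluteGaloisGroup F) :
    ((GaloisRepresentations.FramedRep.dual (GaloisRepresentations.FramedRep.twist σ χ) g :
        GL (Fin n) ℂ) : Matrix (Fin n) (Fin n) ℂ) =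
      ((χ g : ℂ)⁻¹) • ((GaloisRepresentations.FramedRep.dual σ g : GL (Fin n) ℂ) :
        Matrix (Fin n) (Fin n) ℂ) := by
  rw [GaloisRepresentations.FramedRep.coe_dual_apply,
    GaloisRepresentations.FramedRep.coe_dual_apply, GaloisRepresentations.FramedRep.twist_apply,
    mul_inv_rev, Units.val_mul, Matrix.transpose_mul,
    ← map_inv, GaloisRepresentations.FramedRep.coe_scalar_apply, Algebra.algebraMap_eq_smul_one,
    Matrix.transpose_smul, Matrix.transpose_one, smul_one_mul, Units.val_inv_eq_inv_val]

/-- **An unramified character is constant on the Frobenius elements above `u`.**  If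
`χ : Γ_F → ℂˣ` is trivial on every inertia group above `u`, then `χ(g) = χ(g₀)` for any two
arithmetic Frobenius elements `g`, `g₀` at any two primes `𝔓`, `𝔓₀` above `u`: the primes are
conjugate, `𝔓 = τ • 𝔓₀` (`exists_smul_eq_of_mem_primesAbove_holds`), `τ g₀ τ⁻¹` is a Frobenius at
`𝔓` (Mathlib `IsArithFrobAt.conj`), two Frobenius elements at `𝔓` differ by inertia
(`IsArithFrobAt.mul_inv_mem_inertia`), and `ℂˣ` is commutative.  Serre 1968, Ch. I §2.1.
[cite: SerreAbelianLadic1968, Ch. I §2.1] -/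
theorem charValue_eq_of_forall_inertia (χ : absoluteGaloisGroup F →ₜ* ℂˣ)
    {u : HeightOneSpectrum (𝓞 F)}
    (hχ : ∀ 𝔓 ∈ u.primesAbove, ∀ g ∈ 𝔓.inertia (absoluteGaloisGroup F), χ g = 1)
    {𝔓₀ : Ideal (absIntegers (𝓞 F) F)} (h𝔓₀ : 𝔓₀ ∈ u.primesAbove) {g₀ : absoluteGaloisGroup F}
    (hg₀ : IsArithFrobAt (𝓞 F) g₀ 𝔓₀) {𝔓 : Ideal (absIntegers (𝓞 F) F)} (h𝔓 : 𝔓 ∈ u.primesAbove)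
    {g : absoluteGaloisGroup F} (hg : IsArithFrobAt (𝓞 F) g 𝔓) : χ g = χ g₀ := by
  obtain ⟨τ, rfl⟩ := HeightOneSpectrum.exists_smul_eq_of_mem_primesAbove_holds h𝔓₀ h𝔓
  have h1 : IsArithFrobAt (𝓞 F) (τ * g₀ * τ⁻¹) (τ • 𝔓₀) := hg₀.conj τ
  have h2 := hg.mul_inv_mem_inertia h1
  have h3 : χ (g * (τ * g₀ * τ⁻¹)⁻¹) = 1 := hχ _ h𝔓 _ h2
  rw [map_mul, map_inv, mul_inv_eq_one] at h3
  rw [h3, map_mul, map_mul, map_inv, mul_comm (χ τ) (χ g₀), mul_assoc, mul_inv_cancel, mul_one]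

end GaloisSide

/-! ### Euler polynomials with constant term `1` -/

section Polynomials

/-- **A polynomial with constant term `1` is an Euler polynomial.**  For `P ∈ ℂ[X]` with
`P(0) = 1` there is a multiset `B` of non-zero complex numbers with `P = ∏_{b ∈ B} (1 - b X)` and
`card B = deg P`: `P = lc(P) ∏_r (X - r)` over its roots (`ℂ` algebraically closed, Mathlib
`C_leadingCoeff_mul_prod_multiset_X_sub_C`), no root is `0`, `X - r = (-r)(1 - r⁻¹ X)`, and the
scalar in front is `P(0) = 1`; `B = {r⁻¹}`.  (Local L-factors `L(s, π_v) = P_v(q^{-s})⁻¹`,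
`P_v(0) = 1`, as products of Euler terms: Jacquet–Langlands 1970, Thm. 2.18, Props. 3.5–3.6.)
[folklore] -/
theorem exists_eq_eulerPolynomial_of_eval_zero_eq_one (P : ℂ[X]) (hP : P.eval 0 = 1) :
    ∃ B : Multiset ℂ, (0 : ℂ) ∉ B ∧ P = eulerPolynomial B ∧ Multiset.card B = P.natDegree := by
  have hP0 : P ≠ 0 := fun h => by rw [h, eval_zero] at hP; exact zero_ne_one hP
  have hroots : Multiset.card P.roots = P.natDegree := IsAlgClosed.card_roots_eq_natDegree
  have hsplit : C P.leadingCoeff * (P.roots.map fun a => X - C a).prod = P :=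
    C_leadingCoeff_mul_prod_multiset_X_sub_C hroots
  have hr0 : ∀ r ∈ P.roots, r ≠ 0 := fun r hr h0 => by
    rw [h0, mem_roots hP0, IsRoot.def, hP] at hr
    exact one_ne_zero hr
  refine ⟨P.roots.map fun r => r⁻¹, ?_, ?_, by rw [Multiset.card_map, hroots]⟩
  · intro h0
    obtain ⟨r, hr, hr0'⟩ := Multiset.mem_map.mp h0
    exact hr0 r hr (inv_eq_zero.mp hr0')
  · -- `X - r = C(-r) * (1 - C r⁻¹ * X)` for `r ≠ 0`
    have hfac : (P.roots.map fun a => X - C a).prod =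
        (P.roots.map fun a => C (-a)).prod * (P.roots.map fun a => 1 - C a⁻¹ * X).prod := by
      rw [← Multiset.prod_map_mul]
      refine congrArg Multiset.prod (Multiset.map_congr rfl fun r hr => ?_)
      have hr := hr0 r hr
      have h1 : C r * C r⁻¹ = (1 : ℂ[X]) := by rw [← C_mul, mul_inv_cancel₀ hr, C_1]
      rw [C_neg]
      linear_combination (-X) * h1
    have hE : (P.roots.map fun a => 1 - C a⁻¹ * X).prod =
        eulerPolynomial (P.roots.map fun r => r⁻¹) := by
      rw [eulerPolynomial, Multiset.map_map]
      rfl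
    -- the scalar in front is `1`: evaluate at `0`
    have hK : C P.leadingCoeff * (P.roots.map fun a => C (-a)).prod = C 1 := by
      have hCprod : (P.roots.map fun a => C (-a)).prod = C ((P.roots.map fun a => -a).prod) := by
        rw [← Multiset.prod_hom _ C, Multiset.map_map]
        rfl
      rw [hCprod, ← C_mul]
      congr 1
      have h := congrArg (eval 0) hsplit
      rw [hfac, hE, hCprod] at h
      simpa only [eval_mul, eval_C, eval_zero_eulerPolynomial, mul_one, hP, mul_assoc] using h
    calc P = C P.leadingCoeff * (P.roots.map fun a => X - C a).prod := hsplit.symm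
      _ = (C P.leadingCoeff * (P.roots.map fun a => C (-a)).prod) *
            eulerPolynomial (P.roots.map fun r => r⁻¹) := by rw [hfac, hE, mul_assoc]
      _ = eulerPolynomial (P.roots.map fun r => r⁻¹) := by rw [hK, C_1, one_mul]

/-- **Euler polynomials of zero-free multisets determine the multiset**: if `0 ∉ A`, `0 ∉ B` and
`∏_{a ∈ A} (1 - a X) = ∏_{b ∈ B} (1 - b X)` then `A = B` (reverse to the Satake polynomials
`∏ (X - a)`, which have the same degree `card A = card B`, and read off the roots). [folklore] -/
theorem eq_of_eulerPolynomial_eq {A B : Multiset ℂ} (hA : (0 : ℂ) ∉ A) (hB : (0 : ℂ) ∉ B)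
    (h : eulerPolynomial A = eulerPolynomial B) : A = B := by
  have hcard : Multiset.card A = Multiset.card B := by
    rw [← natDegree_eulerPolynomial_of_zero_not_mem hA,
      ← natDegree_eulerPolynomial_of_zero_not_mem hB, h]
  have hS : satakePolynomial A = satakePolynomial B :=
    eq_of_reverse_eq_of_natDegree_eq (by rw [reverse_satakePolynomial, reverse_satakePolynomial, h])
      (by rw [natDegree_satakePolynomial, natDegree_satakePolynomial, hcard])
  rw [← roots_satakePolynomial A, hS, roots_satakePolynomial]

/-- The value of an Euler polynomial at `q^{-s}` is the product of the Euler terms `1 - b q^{-s}`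
(`eval_eulerPolynomial`, `eulerTerm_def`). [folklore] -/
theorem eval_eulerPolynomial_cpow_neg (B : Multiset ℂ) (q : ℕ) (s : ℂ) :
    (eulerPolynomial B).eval ((q : ℂ) ^ (-s)) = (B.map fun b => eulerTerm q b s).prod := by
  rw [eval_eulerPolynomial]
  simp [eulerTerm_def]

end Polynomials

/-! ### One factor of a convergent product in `ℂ` -/

section Products

/-- **Splitting one factor off a convergent product in `ℂ`**: if `∏' x, f x` converges
(unconditionally) and `f b ≠ 0`, then `∏' x, f x = f b · ∏' x, (update f b 1) x`, the second
product converging to `(∏' f) / f b` (partial products over finite sets containing `b`).  Mathlib's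
`Multipliable.tprod_eq_mul_tprod_ite` needs a topological *group*; `(ℂ, ·)` is only a monoid with
zero, so the multipliability of `update f b 1` is proved by hand and fed to
`Multipliable.tprod_eq_mul_tprod_ite'`. [folklore] -/
theorem tprod_eq_mul_tprod_update {β : Type*} [DecidableEq β] {f : β → ℂ} (hf : Multipliable f)
    (b : β) (hb : f b ≠ 0) : ∏' x, f x = f b * ∏' x, Function.update f b 1 x := by
  have hu : Multipliable (Function.update f b 1) := by
    obtain ⟨a, ha⟩ := hf
    refine ⟨a * (f b)⁻¹, ?_⟩
    rw [HasProd, SummationFilter.unconditional_filter] at ha ⊢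
    have h2 : Tendsto (fun s : Finset β => (∏ x ∈ s, f x) * (f b)⁻¹) atTop (𝓝 (a * (f b)⁻¹)) :=
      ha.mul_const _
    refine h2.congr' ?_
    filter_upwards [eventually_ge_atTop {b}] with s hs
    have hbs : b ∈ s := hs (Finset.mem_singleton_self b)
    rw [← Finset.mul_prod_erase s f hbs, ← Finset.mul_prod_erase s (Function.update f b 1) hbs,
      Function.update_self, one_mul, mul_comm (f b), mul_assoc, mul_inv_cancel₀ hb, mul_one]
    exact Finset.prod_congr rfl fun x hx =>
      (Function.update_of_ne (Finset.ne_of_mem_erase hx) _ _).symm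
  rw [hu.tprod_eq_mul_tprod_ite' b]
  congr 1
  exact tprod_congr fun x => by rw [Function.update_apply]

end Products

end Literature.NumberTheory.Automorphic

end
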